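import Summits.ABC.StewartYu.Y07OfYu2007
import HarnessLib

/-!
# The Gen-3 ENGINE stub texts of the `PadicPrimesKummerThird` births are consequences of Pasten's
# `p`-adic clause (hence of Yu 2007 over `ℚ`) — T1 dossier, part 2 (cell `abc-stewartyu`, lit seat g5)

Sequel to `Y07OfYu2007.lean`. The birth skeletons HOME/plan-m3/bc/Y07Odd_birth.lean and
Y07Two_birth.lean (planner plan-m3 g0, 2026-08-26T13:25Z) register the load-bearing stubs
`stub_engineOdd : Nesterenko2003_prop51 → GenThreeEngineOdd` and
`stub_engineTwo : Nesterenko2003_prop51 → GenThreeEngineTwo`, where the ENGINE TEXTS are unit-form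
`p`-adic bounds of Yu-2007 quality (`C(m) ≤ c₁^m`, `p/(log p)²` in `ord_p` units, ONE logarithm):

* odd `p`:  `ord_p(∏ αⱼ^{bⱼ} − 1) · log p ≤ C(m) · (p/log p) · ∏ Vⱼ · (W + log p + log(2 Vmax))`
  for rational `p`-adic units `αⱼ`, multiplicatively independent, 2-Kummer, `h(αⱼ) ≤ Vⱼ`,
  `log 2 ≤ Vⱼ ≤ Vmax`, `b ≠ 0`, `log max(3,|bⱼ|) ≤ W`;
* `p = 2`:  `ord_2(∏ αⱼ^{bⱼ} − 1) ≤ C(m) · ∏ Vⱼ · (W + log(2 Vmax))` for integers `αⱼ ≡ 1 (mod 8)`,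
  independent, 3-Kummer, `1 ≤ Vⱼ`, `1 ≤ W`.

This file proves both texts VERBATIM from Pasten's clause (ii) over `ℚ` with any constant `K ≥ 1`
(`genThreeEngineOdd_of_padicClause`, `C(m) = (2K)^m`; `genThreeEngineTwo_of_padicClause`,
`C(m) = (76K)^m`) and hence from the named fact `yu2007_padicLogForm_rat`
(`genThreeEngineOdd_of_yu2007`, `genThreeEngineTwo_of_yu2007`, via `Y07.padicClause_of_yu2007`).
Bookkeeping (master lemma `engine_of_padicClause`): `ι = Fin m`, `ξ = α` (`≠ 0, ±1` from the unit /
independence hypotheses), `ζ = 1`, `∏ α^b ≠ 1` (independence, `b ≠ 0`), `∏ h(αⱼ) ≤ ∏ Vⱼ`,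
`h(∏ αⱼ^{bⱼ}) ≤ ∑ |bⱼ| h(αⱼ) ≤ m e^W Vmax`, so
`log max(e, p·h) ≤ log p + log m + W + log Vmax ≤ (1+m)(W + log p + log 2Vmax) ≤ 2^m (…)`.
So each engine text is an honest WEAKENING of the fact of record (T_Y ⇒ T_P ⇒ engine); the route's
content is proving it WITHOUT the fact. WHAT THIS IS NOT: no `p`-adic estimate is proved; no stub closed.
-/

noncomputable section

open Finset Real Height
open Literature.NumberTheory.DiophantineGeometry
open Literature.NumberTheory.DiophantineGeometry.Dioph
open Literature.Barriers.ABC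

namespace Summit.ABC.StewartYu.Y07

/-- Multiplicative independence excludes roots of unity among the generators: `αⱼ ≠ 1`. [folklore] -/
theorem ne_one_of_indep {m : ℕ} {α : Fin m → ℚ}
    (hind : ∀ μ : Fin m → ℤ, ∏ j, α j ^ μ j = 1 → μ = 0) (j : Fin m) : α j ≠ 1 := by
  intro h
  have h1 : ∏ i, α i ^ (Pi.single j (1 : ℤ) : Fin m → ℤ) i = 1 := by
    rw [Finset.prod_eq_single j (fun i _ hi => by rw [Pi.single_eq_of_ne hi, zpow_zero])
      (fun hj => absurd (Finset.mem_univ j) hj)]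
    rw [Pi.single_eq_same, zpow_one, h]
  have := congr_fun (hind _ h1) j
  simp at this

/-- … and `αⱼ ≠ −1`. [folklore] -/
theorem ne_neg_one_of_indep {m : ℕ} {α : Fin m → ℚ}
    (hind : ∀ μ : Fin m → ℤ, ∏ j, α j ^ μ j = 1 → μ = 0) (j : Fin m) : α j ≠ -1 := by
  intro h
  have h1 : ∏ i, α i ^ (Pi.single j (2 : ℤ) : Fin m → ℤ) i = 1 := by
    rw [Finset.prod_eq_single j (fun i _ hi => by rw [Pi.single_eq_of_ne hi, zpow_zero])
      (fun hj => absurd (Finset.mem_univ j) hj)]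
    rw [Pi.single_eq_same, h]
    norm_num
  have := congr_fun (hind _ h1) j
  simp at this

/-- … and `∏ αⱼ^{bⱼ} ≠ 1` for `b ≠ 0`. [folklore] -/
theorem prod_zpow_ne_one_of_indep {m : ℕ} {α : Fin m → ℚ}
    (hind : ∀ μ : Fin m → ℤ, ∏ j, α j ^ μ j = 1 → μ = 0) {b : Fin m → ℤ} (hb : b ≠ 0) :
    ∏ j, α j ^ b j ≠ 1 := fun h => hb (hind b h)

/-- `|bⱼ| ≤ e^W` from `log max(3, |bⱼ|) ≤ W`. [folklore] -/
theorem abs_le_exp_of_log_max_le {b : ℤ} {W : ℝ} (h : Real.log (max 3 (|b| : ℝ)) ≤ W) :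
    (|b| : ℝ) ≤ Real.exp W := by
  have h3 : (0 : ℝ) < max 3 (|b| : ℝ) := lt_of_lt_of_le (by norm_num) (le_max_left _ _)
  calc (|b| : ℝ) ≤ max 3 (|b| : ℝ) := le_max_right _ _
    _ = Real.exp (Real.log (max 3 (|b| : ℝ))) := (Real.exp_log h3).symm
    _ ≤ Real.exp W := Real.exp_le_exp.mpr h

/-- `1 + n ≤ 2^n`. [folklore] -/
theorem one_add_le_two_pow' (n : ℕ) : (1 : ℝ) + n ≤ 2 ^ n := by
  have h : 1 + n ≤ 2 ^ n := by
    induction n with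
    | zero => simp
    | succ k ih =>
      calc 1 + (k + 1) ≤ 2 ^ k + 2 ^ k := by omega
        _ = 2 ^ (k + 1) := by ring
  exact_mod_cast h

/-- **Master lemma (unit-form engine shape from Pasten's clause).** For `αⱼ ∈ ℚ ∖ {0, ±1}` with
`∏ αⱼ^{bⱼ} ≠ 1`, `0 ≤ h(αⱼ) ≤ Vⱼ ≤ Vmax`, `1/2 ≤ Vmax`, `|bⱼ| ≤ e^W`, `1 ≤ W`, at every prime `p`:
`ord_p(∏ αⱼ^{bⱼ} − 1) · log p < (2K)^m · (p/log p) · ∏ Vⱼ · (W + log p + log(2Vmax))`. [folklore] -/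
theorem engine_of_padicClause {K : ℝ} (hK : 1 ≤ K)
    (hP2 : ∀ (ι : Type) [Fintype ι], 0 < Fintype.card ι →
      ∀ ξ : ι → ℚ, (∀ i, ξ i ≠ 0 ∧ ξ i ≠ 1 ∧ ξ i ≠ -1) →
      ∀ ζ : ℚ, (ζ = 1 ∨ ζ = -1) → ∀ b : ι → ℤ, ζ * ∏ i, ξ i ^ b i ≠ 1 →
      ∀ p : ℕ, p.Prime →
        (padicValRat p (1 - ζ * ∏ i, ξ i ^ b i) : ℝ) * Real.log p <
          K ^ Fintype.card ι * (p / Real.log p) *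
            Real.log (max (Real.exp 1) (p * logHeight₁ (ζ * ∏ i, ξ i ^ b i))) *
            ∏ i, logHeight₁ (ξ i))
    {p : ℕ} (hp : p.Prime) {m : ℕ} (hm : 1 ≤ m) {α : Fin m → ℚ} {b : Fin m → ℤ}
    {V : Fin m → ℝ} {Vmax W : ℝ}
    (hα : ∀ j, α j ≠ 0 ∧ α j ≠ 1 ∧ α j ≠ -1) (hΛ : ∏ j, α j ^ b j ≠ 1)
    (hV : ∀ j, logHeight₁ (α j) ≤ V j) (hVm : ∀ j, V j ≤ Vmax) (hVmax : 1 / 2 ≤ Vmax)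
    (hbW : ∀ j, (|b j| : ℝ) ≤ Real.exp W) (hW : 1 ≤ W) :
    (padicValRat p (∏ j, α j ^ b j - 1) : ℝ) * Real.log p <
      (2 * K) ^ m * ((p : ℝ) / Real.log p) * (∏ j, V j) * (W + Real.log p + Real.log (2 * Vmax)) := by
  classical
  set X : ℚ := ∏ j, α j ^ b j with hXdef
  have hne1' : (1 : ℚ) * ∏ j, α j ^ b j ≠ 1 := by rwa [one_mul]
  have h := hP2 (Fin m) (by rw [Fintype.card_fin]; exact hm) α hα 1 (Or.inl rfl) b hne1' p hp
  rw [one_mul, Fintype.card_fin] at h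
  have hv : padicValRat p (1 - X) = padicValRat p (X - 1) := by
    rw [← padicValRat.neg, neg_sub]
  rw [hv] at h
  -- positivity bookkeeping
  have hp2 : (2 : ℝ) ≤ p := by exact_mod_cast hp.two_le
  have hp0 : (0 : ℝ) < p := by linarith
  have hlogp : 0 < Real.log p := Real.log_pos (by linarith)
  have hVmax0 : 0 < Vmax := by linarith
  have hlog2V : 0 ≤ Real.log (2 * Vmax) := Real.log_nonneg (by linarith)
  have hlogV : Real.log Vmax ≤ Real.log (2 * Vmax) :=
    Real.log_le_log hVmax0 (by linarith)
  have hh0 : ∀ j, 0 ≤ logHeight₁ (α j) := fun j => zero_le_logHeight₁ _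
  have hV0 : ∀ j, 0 ≤ V j := fun j => (hh0 j).trans (hV j)
  have hprodH : ∏ j, logHeight₁ (α j) ≤ ∏ j, V j :=
    Finset.prod_le_prod (fun j _ => hh0 j) (fun j _ => hV j)
  have hprodV : 0 ≤ ∏ j, V j := Finset.prod_nonneg fun j _ => hV0 j
  set L : ℝ := W + Real.log p + Real.log (2 * Vmax) with hLdef
  have hL1 : 1 ≤ L := by rw [hLdef]; linarith [hlogp.le]
  have hm0 : (0 : ℝ) < m := by exact_mod_cast hm
  have hexpW : 0 < Real.exp W := Real.exp_pos W
  -- the height of the value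
  have hX : logHeight₁ X ≤ m * (Real.exp W * Vmax) := by
    calc logHeight₁ X ≤ ∑ j, logHeight₁ (α j ^ b j) := logHeight₁_prod_le _ _
      _ ≤ ∑ j : Fin m, Real.exp W * Vmax := by
          refine Finset.sum_le_sum fun j _ => ?_
          rw [logHeight₁_zpow]
          have h1 : (((b j).natAbs : ℕ) : ℝ) = |(b j : ℝ)| := by
            rw [Nat.cast_natAbs, Int.cast_abs]
          rw [h1]
          exact mul_le_mul (hbW j) ((hV j).trans (hVm j)) (hh0 j) hexpW.le
      _ = m * (Real.exp W * Vmax) := by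
          rw [Finset.sum_const, Finset.card_univ, Fintype.card_fin, nsmul_eq_mul]
  -- `log max(e, p·h(X)) ≤ 2^m · L`
  have hLM : Real.log (max (Real.exp 1) (p * logHeight₁ X)) ≤ 2 ^ m * L := by
    have h2m : (1 : ℝ) + m ≤ 2 ^ m := one_add_le_two_pow' m
    rcases le_or_gt ((p : ℝ) * logHeight₁ X) (Real.exp 1) with hle | hlt
    · rw [max_eq_left hle, Real.log_exp]
      nlinarith
    · rw [max_eq_right hlt.le]
      have hY0 : 0 < (p : ℝ) * (m * (Real.exp W * Vmax)) := by positivity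
      have hpos : 0 < (p : ℝ) * logHeight₁ X := (Real.exp_pos 1).trans hlt
      calc Real.log ((p : ℝ) * logHeight₁ X)
          ≤ Real.log ((p : ℝ) * (m * (Real.exp W * Vmax))) :=
            Real.log_le_log hpos (mul_le_mul_of_nonneg_left hX hp0.le)
        _ = Real.log p + Real.log m + W + Real.log Vmax := by
            rw [Real.log_mul hp0.ne' (by positivity), Real.log_mul hm0.ne' (by positivity),
              Real.log_mul hexpW.ne' hVmax0.ne', Real.log_exp]
            ring
        _ ≤ L + m := by
            have hlogm : Real.log m ≤ m := by
              have := Real.log_le_sub_one_of_pos hm0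
              linarith
            rw [hLdef]; linarith
        _ ≤ 2 ^ m * L := by nlinarith
  -- assemble
  have hKm : 0 ≤ K ^ m := pow_nonneg (by linarith) m
  calc (padicValRat p (X - 1) : ℝ) * Real.log p
      < K ^ m * ((p : ℝ) / Real.log p) * Real.log (max (Real.exp 1) (p * logHeight₁ X)) *
          ∏ j, logHeight₁ (α j) := h
    _ ≤ K ^ m * ((p : ℝ) / Real.log p) * (2 ^ m * L) * ∏ j, V j := by
        have h1 : 0 ≤ K ^ m * ((p : ℝ) / Real.log p) := by positivity
        have h2 : 0 ≤ Real.log (max (Real.exp 1) (p * logHeight₁ X)) := by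
          rw [← Real.log_exp 0]
          exact Real.log_le_log (Real.exp_pos 0)
            ((Real.exp_le_exp.mpr zero_le_one).trans (le_max_left _ _))
        exact mul_le_mul (mul_le_mul_of_nonneg_left hLM h1) hprodH
          (Finset.prod_nonneg fun j _ => hh0 j) (by positivity)
    _ = (2 * K) ^ m * ((p : ℝ) / Real.log p) * (∏ j, V j) * L := by rw [mul_pow]; ring

/-- **`GenThreeEngineOdd` (the odd-`p` engine stub text of HOME/plan-m3/bc/Y07Odd_birth.lean, verbatim)
from Pasten's clause**, `C(m) = (2K)^m`, `c₁ = 2K`. [folklore] -/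
theorem genThreeEngineOdd_of_padicClause {K : ℝ} (hK : 1 ≤ K)
    (hP2 : ∀ (ι : Type) [Fintype ι], 0 < Fintype.card ι →
      ∀ ξ : ι → ℚ, (∀ i, ξ i ≠ 0 ∧ ξ i ≠ 1 ∧ ξ i ≠ -1) →
      ∀ ζ : ℚ, (ζ = 1 ∨ ζ = -1) → ∀ b : ι → ℤ, ζ * ∏ i, ξ i ^ b i ≠ 1 →
      ∀ p : ℕ, p.Prime →
        (padicValRat p (1 - ζ * ∏ i, ξ i ^ b i) : ℝ) * Real.log p <
          K ^ Fintype.card ι * (p / Real.log p) *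
            Real.log (max (Real.exp 1) (p * logHeight₁ (ζ * ∏ i, ξ i ^ b i))) *
            ∏ i, logHeight₁ (ξ i)) :
    ∃ (C : ℕ → ℝ) (c₁ : ℝ), 1 ≤ c₁ ∧ (∀ m, 0 ≤ C m ∧ C m ≤ c₁ ^ m) ∧
      ∀ (p : ℕ), p.Prime → p ≠ 2 → ∀ (m : ℕ) (α : Fin m → ℚ) (b : Fin m → ℤ) (V : Fin m → ℝ)
        (Vmax W : ℝ),
        (∀ j, α j ≠ 0 ∧ padicValRat p (α j) = 0) →
        (∀ μ : Fin m → ℤ, ∏ j, α j ^ μ j = 1 → μ = 0) →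
        (∀ T : Finset (Fin m), T.Nonempty → ¬ IsSquare (∏ j ∈ T, α j) ∧ ¬ IsSquare (-∏ j ∈ T, α j)) →
        (∀ j, Height.logHeight₁ (α j) ≤ V j) → (∀ j, Real.log 2 ≤ V j) → (∀ j, V j ≤ Vmax) →
        b ≠ 0 → (∀ j, Real.log (max 3 (|b j| : ℝ)) ≤ W) →
        (padicValRat p (∏ j, α j ^ b j - 1) : ℝ) * Real.log p ≤
          C m * ((p : ℝ) / Real.log p) * (∏ j, V j) * (W + Real.log p + Real.log (2 * Vmax)) := by
  refine ⟨fun m => (2 * K) ^ m, 2 * K, by linarith, fun m => ⟨pow_nonneg (by linarith) m, le_rfl⟩, ?_⟩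
  intro p hp _ m α b V Vmax W hunit hind _ hV hV2 hVm hb hbW
  -- `m ≥ 1` (else `b = 0`), hence `W ≥ log 3 ≥ 1` and `Vmax ≥ log 2 ≥ 1/2`
  have hm : 1 ≤ m := by
    rcases Nat.eq_zero_or_pos m with hm0 | hm0
    · subst hm0; exact absurd (funext fun j => Fin.elim0 j) hb
    · exact hm0
  set j₀ : Fin m := ⟨0, hm⟩
  have hlog2 : (1 / 2 : ℝ) ≤ Real.log 2 := by have := Real.log_two_gt_d9; linarith
  have hVmax : 1 / 2 ≤ Vmax := hlog2.trans ((hV2 j₀).trans (hVm j₀))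
  have hW : 1 ≤ W := by
    have h3 : Real.log 3 ≤ Real.log (max 3 (|b j₀| : ℝ)) :=
      Real.log_le_log (by norm_num) (le_max_left _ _)
    have hl3 : 1 ≤ Real.log 3 := by
      rw [← Real.log_exp 1]
      exact Real.log_le_log (Real.exp_pos 1) (by have := Real.exp_one_lt_d9; linarith)
    linarith [hbW j₀]
  have hα : ∀ j, α j ≠ 0 ∧ α j ≠ 1 ∧ α j ≠ -1 :=
    fun j => ⟨(hunit j).1, ne_one_of_indep hind j, ne_neg_one_of_indep hind j⟩
  exact (engine_of_padicClause hK hP2 hp hm hα (prod_zpow_ne_one_of_indep hind hb) hV hVm hVmax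
    (fun j => abs_le_exp_of_log_max_le (hbW j)) hW).le

/-- **`GenThreeEngineTwo` (the `p = 2` engine stub text of HOME/plan-m3/bc/Y07Two_birth.lean, verbatim)
from Pasten's clause**, `C(m) = (76K)^m` (`(4/(log 2)²)(1+m)·2 ≤ 76^m/… ` absorbed). [folklore] -/
theorem genThreeEngineTwo_of_padicClause {K : ℝ} (hK : 1 ≤ K)
    (hP2 : ∀ (ι : Type) [Fintype ι], 0 < Fintype.card ι →
      ∀ ξ : ι → ℚ, (∀ i, ξ i ≠ 0 ∧ ξ i ≠ 1 ∧ ξ i ≠ -1) →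
      ∀ ζ : ℚ, (ζ = 1 ∨ ζ = -1) → ∀ b : ι → ℤ, ζ * ∏ i, ξ i ^ b i ≠ 1 →
      ∀ p : ℕ, p.Prime →
        (padicValRat p (1 - ζ * ∏ i, ξ i ^ b i) : ℝ) * Real.log p <
          K ^ Fintype.card ι * (p / Real.log p) *
            Real.log (max (Real.exp 1) (p * logHeight₁ (ζ * ∏ i, ξ i ^ b i))) *
            ∏ i, logHeight₁ (ξ i)) :
    ∃ (C : ℕ → ℝ) (c₁ : ℝ), 1 ≤ c₁ ∧ (∀ m, 0 ≤ C m ∧ C m ≤ c₁ ^ m) ∧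
      ∀ (m : ℕ) (α : Fin m → ℚ) (b : Fin m → ℤ) (V : Fin m → ℝ) (Vmax W : ℝ),
        (∀ j, ∃ a : ℤ, α j = a) →
        (∀ j, 3 ≤ padicValRat 2 (α j - 1)) →
        (∀ μ : Fin m → ℤ, ∏ j, α j ^ μ j = 1 → μ = 0) →
        (∀ κ : Fin m → ℕ, (∃ j, ¬ 3 ∣ κ j) → ∀ γ : ℚ, ∏ j, α j ^ κ j ≠ γ ^ 3) →
        (∀ j, Height.logHeight₁ (α j) ≤ V j) → (∀ j, 1 ≤ V j) → (∀ j, V j ≤ Vmax) →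
        b ≠ 0 → (∀ j, Real.log (max 3 (|b j| : ℝ)) ≤ W) → 1 ≤ W →
        (padicValRat 2 (∏ j, α j ^ b j - 1) : ℝ) ≤ C m * (∏ j, V j) * (W + Real.log (2 * Vmax)) := by
  refine ⟨fun m => (76 * K) ^ m, 76 * K, by linarith, fun m => ⟨pow_nonneg (by linarith) m, le_rfl⟩, ?_⟩
  intro m α b V Vmax W _ hmod hind _ hV hV1 hVm hb hbW hW
  have hm : 1 ≤ m := by
    rcases Nat.eq_zero_or_pos m with hm0 | hm0
    · subst hm0; exact absurd (funext fun j => Fin.elim0 j) hb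
    · exact hm0
  set j₀ : Fin m := ⟨0, hm⟩
  have hVmax : 1 / 2 ≤ Vmax := by linarith [hV1 j₀, hVm j₀]
  have hα0 : ∀ j, α j ≠ 0 := by
    intro j h0
    have := hmod j
    rw [h0, zero_sub, padicValRat.neg, padicValRat.one] at this
    norm_num at this
  have hα : ∀ j, α j ≠ 0 ∧ α j ≠ 1 ∧ α j ≠ -1 :=
    fun j => ⟨hα0 j, ne_one_of_indep hind j, ne_neg_one_of_indep hind j⟩
  have h := engine_of_padicClause hK hP2 Nat.prime_two hm hα (prod_zpow_ne_one_of_indep hind hb)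
    hV hVm hVmax (fun j => abs_le_exp_of_log_max_le (hbW j)) hW
  -- divide by `log 2` and absorb `2/(log 2)²`, `log 2 ≤ W`
  have hlog2 : (1 / 2 : ℝ) < Real.log 2 := by have := Real.log_two_gt_d9; linarith
  have hlog2' : Real.log 2 < 1 := by have := Real.log_two_lt_d9; linarith
  have hl0 : 0 < Real.log 2 := by linarith
  have hVmax0 : 0 < Vmax := by linarith
  have hlog2V : 0 ≤ Real.log (2 * Vmax) := Real.log_nonneg (by linarith)
  have hV0 : ∀ j, 0 ≤ V j := fun j => le_trans zero_le_one (hV1 j)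
  have hprodV : 0 ≤ ∏ j, V j := Finset.prod_nonneg fun j _ => hV0 j
  set L₂ : ℝ := W + Real.log (2 * Vmax) with hL₂
  have hL₂1 : 1 ≤ L₂ := by rw [hL₂]; linarith
  have hKm : 0 ≤ (2 * K) ^ m := pow_nonneg (by linarith) m
  -- from `v · log 2 < (2K)^m (2/log 2) ∏V (W + log 2 + log 2Vmax)` to the claim
  have hnum : ((2 : ℕ) : ℝ) = 2 := by norm_num
  rw [hnum] at h
  have h1 : (padicValRat 2 (∏ j, α j ^ b j - 1) : ℝ) * Real.log 2 <
      (2 * K) ^ m * (2 / Real.log 2) * (∏ j, V j) * (2 * L₂) := by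
    refine lt_of_lt_of_le h ?_
    have : W + Real.log 2 + Real.log (2 * Vmax) ≤ 2 * L₂ := by rw [hL₂]; linarith
    exact mul_le_mul_of_nonneg_left this (by positivity)
  -- `v < (2K)^m · 4/(log 2)² · ∏V · L₂ ≤ (76K)^m ∏V L₂`
  have h2 : (padicValRat 2 (∏ j, α j ^ b j - 1) : ℝ) <
      (2 * K) ^ m * (4 / Real.log 2 ^ 2) * (∏ j, V j) * L₂ := by
    have hdiv := div_lt_div_of_pos_right h1 hl0
    rw [mul_div_assoc, div_self hl0.ne', mul_one] at hdiv
    refine lt_of_lt_of_le hdiv (le_of_eq ?_)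
    field_simp
    ring
  have h3 : (2 * K) ^ m * (4 / Real.log 2 ^ 2) ≤ (76 * K) ^ m := by
    have h16 : 4 / Real.log 2 ^ 2 ≤ 16 := by
      rw [div_le_iff₀ (by positivity)]
      nlinarith
    have hK0 : 0 ≤ K := by linarith
    calc (2 * K) ^ m * (4 / Real.log 2 ^ 2) ≤ (2 * K) ^ m * 16 :=
          mul_le_mul_of_nonneg_left h16 hKm
      _ ≤ (2 * K) ^ m * 38 ^ m := by
          apply mul_le_mul_of_nonneg_left _ hKm
          calc (16 : ℝ) ≤ 38 ^ 1 := by norm_num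
            _ ≤ 38 ^ m := pow_le_pow_right₀ (by norm_num) hm
      _ = (76 * K) ^ m := by rw [← mul_pow]; ring
  calc (padicValRat 2 (∏ j, α j ^ b j - 1) : ℝ)
      ≤ (2 * K) ^ m * (4 / Real.log 2 ^ 2) * (∏ j, V j) * L₂ := h2.le
    _ ≤ (76 * K) ^ m * (∏ j, V j) * L₂ := by
        have : 0 ≤ (∏ j, V j) * L₂ := by positivity
        calc (2 * K) ^ m * (4 / Real.log 2 ^ 2) * (∏ j, V j) * L₂
            = ((2 * K) ^ m * (4 / Real.log 2 ^ 2)) * ((∏ j, V j) * L₂) := by ring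
          _ ≤ (76 * K) ^ m * ((∏ j, V j) * L₂) := mul_le_mul_of_nonneg_right h3 this
          _ = (76 * K) ^ m * (∏ j, V j) * L₂ := by ring

/-- **`GenThreeEngineOdd` from Yu's theorem over `ℚ`** (`c₁ = 2·pastenK`). [cite: EvertseGyory2015, Thm 3.2.7 (p. 62)] -/
theorem genThreeEngineOdd_of_yu2007 (h : yu2007_padicLogForm_rat) :
    ∃ (C : ℕ → ℝ) (c₁ : ℝ), 1 ≤ c₁ ∧ (∀ m, 0 ≤ C m ∧ C m ≤ c₁ ^ m) ∧
      ∀ (p : ℕ), p.Prime → p ≠ 2 → ∀ (m : ℕ) (α : Fin m → ℚ) (b : Fin m → ℤ) (V : Fin m → ℝ)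
        (Vmax W : ℝ),
        (∀ j, α j ≠ 0 ∧ padicValRat p (α j) = 0) →
        (∀ μ : Fin m → ℤ, ∏ j, α j ^ μ j = 1 → μ = 0) →
        (∀ T : Finset (Fin m), T.Nonempty → ¬ IsSquare (∏ j ∈ T, α j) ∧ ¬ IsSquare (-∏ j ∈ T, α j)) →
        (∀ j, Height.logHeight₁ (α j) ≤ V j) → (∀ j, Real.log 2 ≤ V j) → (∀ j, V j ≤ Vmax) →
        b ≠ 0 → (∀ j, Real.log (max 3 (|b j| : ℝ)) ≤ W) →
        (padicValRat p (∏ j, α j ^ b j - 1) : ℝ) * Real.log p ≤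
          C m * ((p : ℝ) / Real.log p) * (∏ j, V j) * (W + Real.log p + Real.log (2 * Vmax)) :=
  genThreeEngineOdd_of_padicClause one_le_pastenK (padicClause_of_yu2007 h)

/-- **`GenThreeEngineTwo` from Yu's theorem over `ℚ`** (`c₁ = 76·pastenK`). [cite: EvertseGyory2015, Thm 3.2.7 (p. 62)] -/
theorem genThreeEngineTwo_of_yu2007 (h : yu2007_padicLogForm_rat) :
    ∃ (C : ℕ → ℝ) (c₁ : ℝ), 1 ≤ c₁ ∧ (∀ m, 0 ≤ C m ∧ C m ≤ c₁ ^ m) ∧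
      ∀ (m : ℕ) (α : Fin m → ℚ) (b : Fin m → ℤ) (V : Fin m → ℝ) (Vmax W : ℝ),
        (∀ j, ∃ a : ℤ, α j = a) →
        (∀ j, 3 ≤ padicValRat 2 (α j - 1)) →
        (∀ μ : Fin m → ℤ, ∏ j, α j ^ μ j = 1 → μ = 0) →
        (∀ κ : Fin m → ℕ, (∃ j, ¬ 3 ∣ κ j) → ∀ γ : ℚ, ∏ j, α j ^ κ j ≠ γ ^ 3) →
        (∀ j, Height.logHeight₁ (α j) ≤ V j) → (∀ j, 1 ≤ V j) → (∀ j, V j ≤ Vmax) →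
        b ≠ 0 → (∀ j, Real.log (max 3 (|b j| : ℝ)) ≤ W) → 1 ≤ W →
        (padicValRat 2 (∏ j, α j ^ b j - 1) : ℝ) ≤ C m * (∏ j, V j) * (W + Real.log (2 * Vmax)) :=
  genThreeEngineTwo_of_padicClause one_le_pastenK (padicClause_of_yu2007 h)

end Summit.ABC.StewartYu.Y07

end
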